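import Mathlib.RingTheory.Artinian.Module
import Mathlib.LinearAlgebra.Matrix.Rank
import Mathlib.LinearAlgebra.FiniteDimensional.Lemmas
import Mathlib.LinearAlgebra.Dimension.Constructions
import Literature.NumberTheory.Transcendental.AxSchanuelUniv
import Literature.NumberTheory.Transcendental.DerivationExtension
import Literature.NumberTheory.Transcendental.AxDerivationTools
import Literature.NumberTheory.Transcendental.KirbyWeakSchanuelAx
import HarnessLib

/-!
# Kirby 2010, Thm. 6.3 (finitely generated case): extending derivations to exponential pairs

Trunk T-TRANSCEND (`Literature/NumberTheory/Transcendental`). Support for the discharge of the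
named fact `Literature.NumberTheory.Transcendental.Kirby2010_ecl_exchange` (`EclPregeometry.lean`,
J. Kirby, *Exponential algebraicity in exponential fields*, Bull. Lond. Math. Soc. 42 (2010),
Thm. 1.1: `ecl` satisfies Steinitz exchange), whose printed proof (ibid. §7, Prop. 7.1) rests on

> **Theorem 6.3.** Suppose `F₀ ◁ F` is a strong extension of partial E-fields […]. Then every
> E-derivation on `F₀` extends to `F`.

in the case `td(F/F₀) < ∞` (to which Kirby reduces by Prop. 5.6). We prove that case here, for an
abstract field `Λ = F(ā, ē)` generated over a subfield `F` by a tuple `a : Fin r → Λ` and units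
`e : Fin r → Λ` (in the application `eᵢ = exp aᵢ`), phrased without any exponential map:

* `exists_derivOver_defect_eq` (**Kirby's "the `ω̂ᵢ = deᵢ/eᵢ - daᵢ` are linearly independent
  in `Ω(Λ/F)`"**, proof of Thm. 6.3, in dual form): if `(F, ā, ē)` is *strong* — for every
  `ℤ`-matrix `w` with `ℚ`-linearly independent rows, the `s` elements `bₖ = Σᵢ wₖᵢ aᵢ` together
  with `Πᵢ eᵢ^{wₖᵢ}` generate over `F` a field of transcendence degree `≥ s` (Kirby's
  `δ(b̄/F) ≥ 0`) — then the `F`-derivations `v` of `Λ` realise EVERY defect vector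
  `(v eᵢ - eᵢ v aᵢ)ᵢ ∈ Λʳ`.
* `exists_derivation_extend_exp` (**Thm. 6.3, f.g. case**): hence every derivation `δ'` of `Λ`
  can be corrected by an `F`-derivation to a derivation `δ` agreeing with `δ'` on `F` and
  exponential on the pairs, `δ eᵢ = eᵢ δ aᵢ`.

Kirby obtains the independence of the `ω̂ᵢ` from "Fact 6.4", an intermediate step of Ax's proof.
Here it is derived from the tree's Ax theorem WITH its rank term (`Ax1971.add_rank_le_trdeg`,
Ax 1971 Thm. 3, proved in `AxSchanuelUniv.lean`) by a dimension count: with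
`V₀ = Der(Λ/F)` (`dim V₀ ≥ trdeg_F Λ`, `trdeg_le_finrank_derivation`; dimensions are counted in
the image of the injective evaluation map `evalGen : D ↦ (D ā, D ē) ∈ Λʳ × Λʳ`),
`Φ : V₀ → Λʳ` the defect map
and `EΔ = ker Φ` (the E-derivations over `F`, dimension `m`) with basis `D₁, …, D_m` and constants
`k₁ ⊇ F`, Ax's theorem for a maximal sub-tuple `ā°` of `ā` independent modulo `k₁` (`r°` elements)
gives `r° + rank (Dⱼ a°ᵢ) ≤ trdeg_{k₁} Λ`, and `rank = m` because an E-derivation over `F` is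
determined by its values on `ā`; an integral basis `b̄` of `{q | q·ā ∈ k₁}` (`s = r - r°` elements)
has `b̄, ē^{w} ⊆ k₁`, so strongness gives `s ≤ trdeg_F F(b̄, ē^w)` and the tower law
`trdeg_F F(b̄, ē^w) + trdeg_{k₁} Λ ≤ trdeg_F Λ` yields `m + r ≤ trdeg_F Λ ≤ dim V₀`, i.e.
`dim Φ(V₀) ≥ r`: `Φ` is onto.

Also: `exists_finite_family_isQLinearIndependentMod`, the reduction of an arbitrary set of
derivations to a finite family detecting the same `ℚ`-dependences of a tuple (the pattern of
`exists_finite_eDer_family`, `KirbyWeakSchanuelProofs.lean`), and the tower inequality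
`trdeg_add_le_subring` (middle field a subring of the top field).

## References

* J. Kirby, *Exponential algebraicity in exponential fields*, Bull. Lond. Math. Soc. 42 (2010),
  879–890, arXiv:0810.4285: Thm. 6.3 and its proof (p. 9–10), Fact 6.4, Cor. 5.2.
* J. Ax, *On Schanuel's conjectures*, Ann. of Math. 93 (1971), 252–268, Thm. 3.
-/

noncomputable section

open Cardinal

universe u

namespace Literature.NumberTheory.Transcendental

/-! ### From a set of derivations to a finite family -/

section FiniteFamily

variable {K : Type*} [Field K] [CharZero K]

/-- **Finitely many derivations detect the `ℚ`-dependences of a tuple.** If every non-trivial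
integer combination `Σ qᵢ xᵢ` is moved by some derivation of the set `Δ`, then finitely many
members `D₁, …, D_m ∈ Δ` already have `x̄` `ℚ`-linearly independent modulo their common constants
(`IsQLinearIndependentMod D x`): the subspaces of `ℚⁿ` of dependences modulo the constants of
finite subfamilies satisfy the descending chain condition (the argument of
`exists_finite_eDer_family`, Kirby 2010, proof of Cor. 5.2, with `EDer(K/C)` replaced by `Δ`).
[cite: Kirby2010, Cor. 5.2 (proof)] -/
theorem exists_finite_family_isQLinearIndependentMod (Δ : Set (Derivation ℤ K K)) {n : ℕ}
    {x : Fin n → K}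
    (hx : ∀ q : Fin n → ℤ, (∀ D ∈ Δ, D (∑ i, (q i : K) * x i) = 0) → q = 0) :
    ∃ (m : ℕ) (D : Fin m → Derivation ℤ K K),
      (∀ j, D j ∈ Δ) ∧ Transcendental.IsQLinearIndependentMod D x := by
  classical
  -- dependence spaces of finite families: `v ∈ W p` iff every `p.2 j` kills `∑ vᵢ xᵢ`
  let W : (Σ m : ℕ, Fin m → Derivation ℤ K K) → Submodule ℚ (Fin n → ℚ) := fun p =>
    ⨅ j, LinearMap.ker ((p.2 j).toLinearMap.toAddMonoidHom.toRatLinearMap ∘ₗ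
      Fintype.linearCombination ℚ x)
  have hmemW : ∀ (p : Σ m : ℕ, Fin m → Derivation ℤ K K) (v : Fin n → ℚ),
      v ∈ W p ↔ ∀ j, p.2 j (∑ i, v i • x i) = 0 := fun p v => by
    simp only [W, Submodule.mem_iInf, LinearMap.mem_ker, LinearMap.comp_apply,
      Fintype.linearCombination_apply, AddMonoidHom.coe_toRatLinearMap,
      LinearMap.toAddMonoidHom_coe, Derivation.coeFn_coe]
  -- the achievable dependence spaces, and a minimal one
  set Wset : Set (Submodule ℚ (Fin n → ℚ)) :=
    Set.range fun p : (Σ m : ℕ, Fin m → Δ) => W ⟨p.1, fun j => (p.2 j).1⟩ with hWset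
  have hWne : Wset.Nonempty :=
    ⟨_, Set.mem_range_self (⟨0, Fin.elim0⟩ : Σ m : ℕ, Fin m → Δ)⟩
  obtain ⟨M', ⟨⟨m, D⟩, rfl⟩, hmin⟩ := IsArtinian.set_has_minimal Wset hWne
  refine ⟨m, fun j => (D j).1, fun j => (D j).2, ?_⟩
  -- minimality: every member of `Δ` kills the combinations recorded by `D`
  have hall : ∀ v ∈ W ⟨m, fun j => (D j).1⟩, ∀ D' ∈ Δ, D' (∑ i, v i • x i) = 0 := by
    intro v hv D' hD'
    have hle : W ⟨m + 1, fun j => (Fin.snoc (α := fun _ => Δ) D ⟨D', hD'⟩ j).1⟩ ≤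
        W ⟨m, fun j => (D j).1⟩ := by
      intro w hw
      rw [hmemW] at hw ⊢
      intro j
      simpa only [Fin.snoc_castSucc] using hw (Fin.castSucc j)
    have heq : W ⟨m + 1, fun j => (Fin.snoc (α := fun _ => Δ) D ⟨D', hD'⟩ j).1⟩ =
        W ⟨m, fun j => (D j).1⟩ :=
      eq_of_le_of_not_lt hle
        (hmin _ (Set.mem_range_self
          (⟨m + 1, Fin.snoc (α := fun _ => Δ) D ⟨D', hD'⟩⟩ : Σ m : ℕ, Fin m → Δ)))
    rw [← heq, hmemW] at hv
    simpa only [Fin.snoc_last] using hv (Fin.last m)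
  -- conclusion
  intro q hq
  set v : Fin n → ℚ := fun i => (q i : ℚ) with hv
  have hsum : (∑ i, v i • x i) = ∑ i, (q i : K) * x i :=
    Finset.sum_congr rfl fun i _ => by rw [hv, Rat.smul_def, Rat.cast_intCast]
  have hvmem : v ∈ W ⟨m, fun j => (D j).1⟩ := by
    rw [hmemW]
    intro j
    rw [hsum]
    exact hq j
  refine hx q fun D' hD' => ?_
  rw [← hsum]
  exact hall v hvmem D' hD'

end FiniteFamily

/-! ### A tower inequality -/

section Tower

/-- Tower inequality `trdeg_F N + trdeg_E Λ ≤ trdeg_F Λ` for an intermediate field `N` of `Λ/F`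
and a subring `E` of `Λ` containing (the images of) `F` and `N` (Mathlib's `trdeg_add_le`, with
the `F`-algebra structure on `E` supplied locally; cf. `trdeg_add_le_of_le_subring`). [folklore] -/
theorem trdeg_add_le_subring {F Λ : Type u} [Field F] [Field Λ] [Algebra F Λ]
    (N : IntermediateField F Λ) (E : Subring Λ)
    (hFE : ∀ c : F, algebraMap F Λ c ∈ E) (hNE : ∀ t : Λ, t ∈ N → t ∈ E) :
    Algebra.trdeg F N + Algebra.trdeg E Λ ≤ Algebra.trdeg F Λ := by
  letI alg : Algebra F E := ((algebraMap F Λ).codRestrict E hFE).toAlgebra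
  have halg : ∀ c : F, (algebraMap F E c : Λ) = algebraMap F Λ c := fun _ => rfl
  haveI : IsScalarTower F E Λ := IsScalarTower.of_algebraMap_eq fun c => (halg c).symm
  haveI : FaithfulSMul F E := (faithfulSMul_iff_algebraMap_injective F E).mpr fun a b hab => by
    have := congrArg ((↑) : E → Λ) hab
    rw [halg, halg] at this
    exact (algebraMap F Λ).injective this
  haveI : FaithfulSMul E Λ :=
    (faithfulSMul_iff_algebraMap_injective E Λ).mpr fun a b hab => Subtype.ext hab
  let ι' : N →ₐ[F] E :=
    { toFun := fun t => ⟨t, hNE t t.2⟩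
      map_one' := rfl
      map_mul' := fun _ _ => rfl
      map_zero' := rfl
      map_add' := fun _ _ => rfl
      commutes' := fun _ => rfl }
  have hι' : Function.Injective ι' := fun a b hab => by
    have := congrArg (fun t : E => (t : Λ)) hab
    exact Subtype.ext this
  calc Algebra.trdeg F N + Algebra.trdeg E Λ
      ≤ Algebra.trdeg F E + Algebra.trdeg E Λ := by
        gcongr
        exact trdeg_le_of_injective ι' hι'
    _ ≤ Algebra.trdeg F Λ := trdeg_add_le

end Tower

/-! ### Common kernels of derivations as `ℚ`-subspaces, and a splitting lemma -/

section RatKer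

variable {Λ : Type*} [Field Λ] [CharZero Λ]

/-- A derivation of a field of characteristic zero is `ℚ`-linear. [folklore] -/
theorem derivation_map_rat_smul (D : Derivation ℤ Λ Λ) (q : ℚ) (x : Λ) :
    D (q • x) = q • D x := by
  rw [Rat.smul_def, Derivation.leibniz, derivation_map_ratCast, smul_zero, add_zero, smul_eq_mul,
    Rat.smul_def]

/-- The common kernel of a set of derivations of `Λ`, as a `ℚ`-subspace of `Λ` (it is even a
subfield, cf. `Transcendental.constantSubring`). [cite: Ax1971, Thm. 3] [folklore] -/
def ratKer (S : Set (Derivation ℤ Λ Λ)) : Submodule ℚ Λ where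
  carrier := {x | ∀ D ∈ S, D x = 0}
  add_mem' {x y} hx hy D hD := by rw [map_add, hx D hD, hy D hD, add_zero]
  zero_mem' D _ := map_zero D
  smul_mem' q {x} hx D hD := by rw [derivation_map_rat_smul, hx D hD, smul_zero]

/-- Membership in `ratKer S`. [folklore] -/
@[simp] theorem mem_ratKer_iff {S : Set (Derivation ℤ Λ Λ)} {x : Λ} :
    x ∈ ratKer S ↔ ∀ D ∈ S, D x = 0 :=
  Iff.rfl

/-- Membership in the common kernel of a family. [folklore] -/
theorem mem_ratKer_range_iff {ι : Type*} {D : ι → Derivation ℤ Λ Λ} {x : Λ} :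
    x ∈ ratKer (Set.range D) ↔ ∀ j, D j x = 0 := by
  simp only [mem_ratKer_iff, Set.forall_mem_range]

omit [CharZero Λ] in
/-- A finite sum of derivations, evaluated. [folklore] -/
theorem derivation_sum_apply {ι : Type*} (s : Finset ι) (D : ι → Derivation ℤ Λ Λ) (x : Λ) :
    (∑ j ∈ s, D j) x = ∑ j ∈ s, D j x := by
  classical
  induction s using Finset.induction_on with
  | empty => simp
  | insert j s hj ih => rw [Finset.sum_insert hj, Finset.sum_insert hj, Derivation.add_apply, ih]

end RatKer

section Split

variable {Λ : Type*} [AddCommGroup Λ] [Module ℚ Λ] {r : ℕ}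

/-- **Splitting a tuple modulo a `ℚ`-subspace.** For a `ℚ`-subspace `N` of `Λ` and a tuple
`a : Fin r → Λ` there are a sub-tuple `a ∘ ι` (`r'` elements) which is `ℚ`-linearly independent
modulo `N` and generates `ā` modulo `N`, and an integer matrix `w` with `ℚ`-linearly independent rows
(`s` of them, `r' + s = r`) whose combinations `Σᵢ wₖᵢ aᵢ` lie in `N` and span, as coefficient
vectors, all `ℚ`-dependences of `ā` modulo `N` (an integral basis of `{v ∈ ℚʳ | Σ vᵢ aᵢ ∈ N}`).
This is the bookkeeping of Kirby's "`a₁, …, aₙ` a `ℚ`-linear basis of `A(F)` over `A(C)`"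
(Kirby 2010, Lemma 4.8, Thm. 6.3) as carried out in `card_le_relTrdeg_of_isEclClosed`.
[folklore] -/
theorem exists_split_mod (N : Submodule ℚ Λ) (a : Fin r → Λ) :
    ∃ (r' s : ℕ) (ι : Fin r' → Fin r) (w : Fin s → Fin r → ℤ), r' + s = r ∧
      LinearIndependent ℚ (fun k i => (w k i : ℚ)) ∧
      (∀ k, (∑ i, (w k i : ℚ) • a i) ∈ N) ∧
      (∀ q : Fin r' → ℚ, (∑ i, q i • a (ι i)) ∈ N → q = 0) ∧
      (∀ i, ∃ f : Fin r' → ℚ, a i - ∑ k, f k • a (ι k) ∈ N) ∧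
      (∀ v : Fin r → ℚ, (∑ i, v i • a i) ∈ N →
        v ∈ Submodule.span ℚ (Set.range (fun k i => (w k i : ℚ)))) := by
  classical
  set T : (Fin r → ℚ) →ₗ[ℚ] Λ := Fintype.linearCombination ℚ a with hT
  have hTapply : ∀ v : Fin r → ℚ, T v = ∑ i, v i • a i := fun v =>
    Fintype.linearCombination_apply ℚ a v
  set V : Submodule ℚ (Fin r → ℚ) := N.comap T with hV
  set T' : (Fin r → ℚ) →ₗ[ℚ] Λ ⧸ N := N.mkQ ∘ₗ T with hT'
  have hker : LinearMap.ker T' = V := by rw [hT', LinearMap.ker_comp, Submodule.ker_mkQ]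
  obtain ⟨κ, ι₀, hι₀, hspan, hli⟩ := exists_linearIndependent' ℚ ((Submodule.mkQ N) ∘ a)
  haveI : Fintype κ := Fintype.ofInjective ι₀ hι₀
  set r' := Fintype.card κ with hr'
  set eκ := Fintype.equivFin κ with heκ
  have hrange : Module.finrank ℚ (LinearMap.range T') = r' := by
    have h1 : LinearMap.range T' = Submodule.span ℚ (Set.range (N.mkQ ∘ a)) := by
      rw [hT', LinearMap.range_comp, hT, Fintype.range_linearCombination, Submodule.map_span,
        ← Set.range_comp]
    rw [h1, ← hspan, finrank_span_eq_card hli]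
  set s := Module.finrank ℚ V with hs
  have hrs : r' + s = r := by
    have := LinearMap.finrank_range_add_finrank_ker T'
    rwa [hrange, hker, Module.finrank_fin_fun] at this
  -- an integral basis of `V`
  let bV := Module.finBasis ℚ V
  have hint : ∀ k : Fin s, ∃ d : ℕ, d ≠ 0 ∧ ∃ w : Fin r → ℤ,
      ∀ i, (d : ℚ) * ((bV k : V) : Fin r → ℚ) i = w i := fun k => exists_nat_mul_eq_intCast _
  choose d hd w hw using hint
  have hwrow : ∀ k, (fun i => (w k i : ℚ)) = (d k : ℚ) • ((bV k : V) : Fin r → ℚ) := fun k => by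
    funext i; rw [Pi.smul_apply, smul_eq_mul, hw]
  have huV : ∀ k, (fun i => (w k i : ℚ)) ∈ V := fun k => by
    rw [hwrow]
    exact V.smul_mem _ (bV k).2
  have hli_w : LinearIndependent ℚ (fun k => fun i => (w k i : ℚ)) := by
    have hb : LinearIndependent ℚ (fun k => ((bV k : V) : Fin r → ℚ)) :=
      bV.linearIndependent.map' V.subtype (Submodule.ker_subtype V)
    have hb2 := hb.units_smul fun k => Units.mk0 (d k : ℚ) (Nat.cast_ne_zero.mpr (hd k))
    convert hb2 using 1
    funext k i
    change (w k i : ℚ) = ((Units.mk0 (d k : ℚ) (Nat.cast_ne_zero.mpr (hd k))) •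
      ((bV k : V) : Fin r → ℚ)) i
    rw [Units.smul_def, Units.val_mk0, Pi.smul_apply, smul_eq_mul, hw]
  have hli' : LinearIndependent ℚ ((N.mkQ ∘ a ∘ ι₀) ∘ eκ.symm) :=
    hli.comp eκ.symm eκ.symm.injective
  refine ⟨r', s, ι₀ ∘ eκ.symm, w, hrs, hli_w, fun k => ?_, fun q hq => ?_, fun i => ?_,
    fun v hv => ?_⟩
  · -- the combinations `Σ wₖᵢ aᵢ` lie in `N`
    have h := Submodule.mem_comap.mp (huV k)
    rwa [hTapply] at h
  · -- `a ∘ ι` is independent modulo `N`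
    have h0 : ∑ i, q i • ((N.mkQ ∘ a ∘ ι₀) ∘ eκ.symm) i = 0 := by
      have h1 : N.mkQ (∑ i, q i • a ((ι₀ ∘ eκ.symm) i)) = 0 :=
        (Submodule.Quotient.mk_eq_zero N).mpr hq
      rw [map_sum] at h1
      simpa only [map_smul, Function.comp_apply] using h1
    funext i
    exact Fintype.linearIndependent_iff.mp hli' q h0 i
  · -- `a ∘ ι` generates `ā` modulo `N`
    have hmem : N.mkQ (a i) ∈ Submodule.span ℚ (Set.range ((N.mkQ ∘ a) ∘ ι₀)) := by
      rw [hspan]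
      exact Submodule.subset_span ⟨i, rfl⟩
    obtain ⟨c, hc⟩ := (Submodule.mem_span_range_iff_exists_fun ℚ).mp hmem
    refine ⟨c ∘ eκ.symm, ?_⟩
    rw [← Submodule.Quotient.mk_eq_zero, ← Submodule.mkQ_apply, map_sub, map_sum, sub_eq_zero]
    simp only [map_smul, Function.comp_apply] at hc ⊢
    rw [← hc]
    exact (Equiv.sum_comp eκ.symm (fun k => c k • N.mkQ (a (ι₀ k)))).symm
  · -- the rows of `w` span the dependences
    have hvV : v ∈ V := by
      rw [hV, Submodule.mem_comap, hTapply]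
      exact hv
    have hbVmem : ∀ k, ((bV k : V) : Fin r → ℚ) ∈
        Submodule.span ℚ (Set.range (fun k i => (w k i : ℚ))) := fun k => by
      have : ((bV k : V) : Fin r → ℚ) = (d k : ℚ)⁻¹ • (fun i => (w k i : ℚ)) := by
        rw [hwrow, smul_smul, inv_mul_cancel₀ (Nat.cast_ne_zero.mpr (hd k)), one_smul]
      rw [this]
      exact Submodule.smul_mem _ _ (Submodule.subset_span ⟨k, rfl⟩)
    have h := congrArg (fun t : V => (t : Fin r → ℚ)) (bV.sum_repr ⟨v, hvV⟩)
    simp only [Submodule.coe_sum, Submodule.coe_smul] at h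
    rw [← h]
    exact Submodule.sum_mem _ fun k _ => Submodule.smul_mem _ _ (hbVmem k)

end Split

/-! ### Derivations over a subfield, E-derivations on pairs, and the exponential defect map -/

section Ext

variable {F Λ : Type u} [Field F] [Field Λ] [Algebra F Λ] {r : ℕ}

variable (F Λ) in
/-- The `Λ`-space of derivations of `Λ` vanishing on (the image of) `F` (Kirby's `Der(Λ/F)`),
as a submodule of all derivations. [cite: Kirby2010, Def. 4.1] -/
def derivOver : Submodule Λ (Derivation ℤ Λ Λ) where
  carrier := {D | ∀ c : F, D (algebraMap F Λ c) = 0}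
  zero_mem' c := by simp
  add_mem' {D D'} hD hD' c := by rw [Derivation.add_apply, hD c, hD' c, add_zero]
  smul_mem' t {D} hD c := by rw [Derivation.smul_apply, hD c, smul_zero]

/-- Membership in `derivOver F Λ`. [cite: Kirby2010, Def. 4.1] -/
@[simp] theorem mem_derivOver_iff {D : Derivation ℤ Λ Λ} :
    D ∈ derivOver F Λ ↔ ∀ c : F, D (algebraMap F Λ c) = 0 :=
  Iff.rfl

variable (F) in
/-- The `Λ`-space `EDer(Λ/F)` of derivations over `F` which are exponential on the pairs
`(aᵢ, eᵢ)`: `D eᵢ = eᵢ D aᵢ` (Kirby 2010, Def. 4.1, for the partial exponential `aᵢ ↦ eᵢ`).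
[cite: Kirby2010, Def. 4.1] -/
def eDerivOver (a e : Fin r → Λ) : Submodule Λ (Derivation ℤ Λ Λ) where
  carrier := {D | (∀ c : F, D (algebraMap F Λ c) = 0) ∧ ∀ i, D (e i) = e i * D (a i)}
  zero_mem' := ⟨fun c => by simp, fun i => by simp⟩
  add_mem' {D D'} hD hD' :=
    ⟨fun c => by rw [Derivation.add_apply, hD.1 c, hD'.1 c, add_zero],
      fun i => by rw [Derivation.add_apply, hD.2 i, hD'.2 i, Derivation.add_apply, mul_add]⟩
  smul_mem' t {D} hD :=
    ⟨fun c => by rw [Derivation.smul_apply, hD.1 c, smul_zero],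
      fun i => by rw [Derivation.smul_apply, hD.2 i, Derivation.smul_apply, smul_eq_mul,
        smul_eq_mul, mul_left_comm]⟩

/-- Membership in `eDerivOver F a e`. [cite: Kirby2010, Def. 4.1] -/
@[simp] theorem mem_eDerivOver_iff {a e : Fin r → Λ} {D : Derivation ℤ Λ Λ} :
    D ∈ eDerivOver F a e ↔ (∀ c : F, D (algebraMap F Λ c) = 0) ∧ ∀ i, D (e i) = e i * D (a i) :=
  Iff.rfl

/-- `EDer(Λ/F) ≤ Der(Λ/F)`. [cite: Kirby2010, Def. 4.1] -/
theorem eDerivOver_le_derivOver (a e : Fin r → Λ) : eDerivOver F a e ≤ derivOver F Λ :=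
  fun _ hD => hD.1

/-- Evaluation of derivations at the generators `ā, ē`: a `Λ`-linear map to the honest vector
space `Λʳ × Λʳ` (injective on `Der(Λ/F)` when `Λ = F(ā, ē)`; all dimension counts below are
carried out in its image). [folklore] -/
def evalGen (a e : Fin r → Λ) : Derivation ℤ Λ Λ →ₗ[Λ] (Fin r → Λ) × (Fin r → Λ) where
  toFun D := (fun i => D (a i), fun i => D (e i))
  map_add' _ _ := rfl
  map_smul' _ _ := rfl

/-- Unfolding lemmas for `evalGen`. [folklore] -/
@[simp] theorem evalGen_apply_fst (a e : Fin r → Λ) (D : Derivation ℤ Λ Λ) (i : Fin r) :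
    (evalGen a e D).1 i = D (a i) := rfl

/-- Unfolding lemmas for `evalGen`. [folklore] -/
@[simp] theorem evalGen_apply_snd (a e : Fin r → Λ) (D : Derivation ℤ Λ Λ) (i : Fin r) :
    (evalGen a e D).2 i = D (e i) := rfl

/-- If `Λ = F(ā, ē)`, a derivation over `F` is determined by its values on `ā, ē`. [folklore] -/
theorem eq_of_evalGen_eq {a e : Fin r → Λ}
    (htop : IntermediateField.adjoin F (Set.range a ∪ Set.range e) = ⊤) {D D' : Derivation ℤ Λ Λ}
    (hD : D ∈ derivOver F Λ) (hD' : D' ∈ derivOver F Λ) (h : evalGen a e D = evalGen a e D') :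
    D = D' := by
  have h1 : ∀ i, D (a i) = D' (a i) := fun i => congr_fun (congrArg Prod.fst h) i
  have h2 : ∀ i, D (e i) = D' (e i) := fun i => congr_fun (congrArg Prod.snd h) i
  rw [← sub_eq_zero]
  refine derivation_eq_zero_of_adjoin_eq_top (D - D')
    (fun c => by rw [Derivation.sub_apply, hD c, hD' c, sub_zero]) ?_ htop
  rintro s (⟨i, rfl⟩ | ⟨i, rfl⟩)
  · rw [Derivation.sub_apply, h1 i, sub_self]
  · rw [Derivation.sub_apply, h2 i, sub_self]

/-- The **exponential defect** read off from the values at the generators: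
`(p, q) ↦ (qᵢ - eᵢ pᵢ)ᵢ`, so that `defectVec e (evalGen a e D) = (D eᵢ - eᵢ D aᵢ)ᵢ` (zero iff `D`
is an E-derivation for `eᵢ = exp aᵢ`). [cite: Kirby2010, Def. 4.1] -/
def defectVec (e : Fin r → Λ) : (Fin r → Λ) × (Fin r → Λ) →ₗ[Λ] (Fin r → Λ) where
  toFun pq i := pq.2 i - e i * pq.1 i
  map_add' pq pq' := by
    funext i
    simp only [Prod.snd_add, Prod.fst_add, Pi.add_apply]
    ring
  map_smul' t pq := by
    funext i
    simp only [Prod.smul_snd, Prod.smul_fst, Pi.smul_apply, smul_eq_mul, RingHom.id_apply]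
    ring

/-- Unfolding lemma for `defectVec ∘ evalGen`. [cite: Kirby2010, Def. 4.1] -/
@[simp] theorem defectVec_evalGen (a e : Fin r → Λ) (D : Derivation ℤ Λ Λ) (i : Fin r) :
    defectVec e (evalGen a e D) i = D (e i) - e i * D (a i) := rfl

/-- `trdeg_F Λ ≤ dim_Λ Der(Λ/F)` for `Λ = F(ā, ē)`, with `Der(Λ/F)` measured through its
(isomorphic) image under `evalGen` (`trdeg_le_finrank_derivation`, transported).
[cite: Rosenlicht1976, Prop. 3] [folklore] -/
theorem trdeg_le_finrank_map_derivOver [CharZero Λ] (a e : Fin r → Λ)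
    (htop : IntermediateField.adjoin F (Set.range a ∪ Set.range e) = ⊤) :
    Algebra.trdeg F Λ ≤
      (Module.finrank Λ ((derivOver F Λ).map (evalGen a e)) : Cardinal) := by
  haveI : CharZero F := (algebraMap F Λ).charZero
  set W₀ := (derivOver F Λ).map (evalGen a e) with hW₀
  have hmem : ∀ D : Derivation F Λ Λ, D.restrictScalars ℤ ∈ derivOver F Λ := fun D c =>
    D.map_algebraMap c
  let ρ : Derivation F Λ Λ →ₗ[Λ] W₀ :=
    { toFun := fun D => ⟨evalGen a e (D.restrictScalars ℤ),
        Submodule.mem_map.mpr ⟨_, hmem D, rfl⟩⟩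
      map_add' := fun D D' => rfl
      map_smul' := fun t D => rfl }
  have hρ : Function.Injective ρ := fun D D' h => by
    have h' : evalGen a e (D.restrictScalars ℤ) = evalGen a e (D'.restrictScalars ℤ) :=
      congrArg (fun t : W₀ => (t : (Fin r → Λ) × (Fin r → Λ))) h
    have := eq_of_evalGen_eq htop (hmem D) (hmem D') h'
    ext x
    exact congrArg (fun E : Derivation ℤ Λ Λ => E x) this
  haveI : Module.Finite Λ (Derivation F Λ Λ) := Module.Finite.of_injective ρ hρ
  exact trdeg_le_finrank_derivation.trans
    (Nat.cast_le.mpr (LinearMap.finrank_le_finrank_of_injective hρ))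

/-- **The rank term in Ax's theorem for a basis of E-derivations.** If `D₁, …, D_m` are
`Λ`-linearly independent E-derivations of `Λ = F(ā, ē)` over `F` and the sub-tuple `a ∘ ι`
generates `ā` modulo the common constants of the `Dⱼ`, then the matrix `(Dⱼ a_{ι i})` has rank
`m`: an E-derivation over `F` is determined by its values on `ā`, and those by its values on
`a ∘ ι` (Kirby 2010, proof of Cor. 5.2: "derivations `∂₁, …, ∂_m` with `∂ⱼ x_{i_k} = δ_{jk}` …
thus `rk = m`"). [cite: Kirby2010, Cor. 5.2 (proof)] -/
theorem rank_eval_eq_of_linearIndependent [CharZero Λ] {a e : Fin r → Λ}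
    (htop : IntermediateField.adjoin F (Set.range a ∪ Set.range e) = ⊤) {m : ℕ}
    {D : Fin m → Derivation ℤ Λ Λ} (hD : ∀ j, D j ∈ eDerivOver F a e)
    (hli : LinearIndependent Λ D) {r' : ℕ} (ι : Fin r' → Fin r)
    (hgen : ∀ i, ∃ f : Fin r' → ℚ, a i - ∑ k, f k • a (ι k) ∈ ratKer (Set.range D)) :
    (Matrix.of fun i j => D j (a (ι i))).rank = m := by
  classical
  set M₀ : Matrix (Fin r') (Fin m) Λ := Matrix.of fun i j => D j (a (ι i)) with hM₀
  have hcols : LinearIndependent Λ M₀.col := by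
    rw [Fintype.linearIndependent_iff]
    intro c hc j₀
    -- the combination `Dc = Σ cⱼ Dⱼ` vanishes on `a ∘ ι`, hence on `ā`, `ē`, `F`, hence is `0`
    set Dc : Derivation ℤ Λ Λ := ∑ j, c j • D j with hDc
    have hDc_apply : ∀ x, Dc x = ∑ j, c j * D j x := fun x => by
      rw [hDc, derivation_sum_apply]
      exact Finset.sum_congr rfl fun j _ => by rw [Derivation.smul_apply, smul_eq_mul]
    have hDc_ι : ∀ i, Dc (a (ι i)) = 0 := fun i => by
      rw [hDc_apply]
      have := congr_fun hc i
      simpa only [Finset.sum_apply, Pi.smul_apply, smul_eq_mul, Pi.zero_apply, hM₀,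
        Matrix.col_apply, Matrix.of_apply] using this
    have hDc_N : ∀ x ∈ ratKer (Set.range D), Dc x = 0 := fun x hx => by
      rw [hDc_apply]
      exact Finset.sum_eq_zero fun j _ => by rw [mem_ratKer_range_iff.mp hx j, mul_zero]
    have hDc_a : ∀ i, Dc (a i) = 0 := fun i => by
      obtain ⟨f, hf⟩ := hgen i
      have h1 := hDc_N _ hf
      rw [map_sub, map_sum, sub_eq_zero] at h1
      rw [h1]
      exact Finset.sum_eq_zero fun k _ => by rw [derivation_map_rat_smul, hDc_ι k, smul_zero]
    have hDc_e : ∀ i, Dc (e i) = 0 := fun i => by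
      have : Dc (e i) = e i * Dc (a i) := by
        rw [hDc_apply, hDc_apply, Finset.mul_sum]
        exact Finset.sum_congr rfl fun j _ => by rw [(hD j).2 i, mul_left_comm]
      rw [this, hDc_a i, mul_zero]
    have hDc_F : ∀ c' : F, Dc (algebraMap F Λ c') = 0 := fun c' => by
      rw [hDc_apply]
      exact Finset.sum_eq_zero fun j _ => by rw [(hD j).1 c', mul_zero]
    have hDc0 : Dc = 0 := by
      refine derivation_eq_zero_of_adjoin_eq_top _ hDc_F ?_ htop
      rintro x (⟨i, rfl⟩ | ⟨i, rfl⟩)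
      · exact hDc_a i
      · exact hDc_e i
    exact Fintype.linearIndependent_iff.mp hli c hDc0 j₀
  rw [Matrix.rank_eq_finrank_span_cols, finrank_span_eq_card hcols, Fintype.card_fin]

/-! ### The dimension count: `dim EDer(Λ/F) + r ≤ trdeg_F Λ` for strong `(F, ā, ē)` -/

/-- **The E-derivations over `F` have the expected dimension** (Kirby 2010, proof of Thm. 6.3:
"`Ann(Λ)` has codimension `n` in `Der(F₂/F₁)`", there from Fact 6.4; here from Ax 1971 Thm. 3
with its rank term). Let `Λ = F(ā, ē)` with `eᵢ ≠ 0` and suppose `(F, ā, ē)` is strong: for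
every integer matrix `w` with `ℚ`-linearly independent rows `w₁, …, w_s`,
`s ≤ trdeg_F F(b̄, ē^w)` where `bₖ = Σᵢ wₖᵢ aᵢ`, `(ē^w)ₖ = Πᵢ eᵢ^{wₖᵢ}`. Then
`dim_Λ EDer(Λ/F) + r ≤ trdeg_F Λ`. Proof: for a basis `D₁, …, D_m` of `EDer(Λ/F)` with constants
`k₁`, split `ā` modulo `k₁` (`exists_split_mod`: `r = r' + s`); Ax's theorem for the independent
part gives `r' + m ≤ trdeg_{k₁} Λ` (`rank_eval_eq_of_linearIndependent`), strongness for the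
integral relations `b̄ ⊆ k₁` (with `ē^w ⊆ k₁`) gives `s ≤ trdeg_F F(b̄, ē^w)`, and the tower law
through `k₁` adds them up. [cite: Kirby2010, Thm. 6.3 (proof)] -/
theorem finrank_eDerivOver_add_le_trdeg [CharZero Λ] (a e : Fin r → Λ) (he : ∀ i, e i ≠ 0)
    (htop : IntermediateField.adjoin F (Set.range a ∪ Set.range e) = ⊤)
    (hstrong : ∀ (s : ℕ) (w : Fin s → Fin r → ℤ),
      LinearIndependent ℚ (fun k i => (w k i : ℚ)) →
        (s : Cardinal) ≤ Algebra.trdeg F (IntermediateField.adjoin F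
          (Set.range (fun k => ∑ i, (w k i : Λ) * a i) ∪
            Set.range (fun k => ∏ i, e i ^ w k i)))) :
    ((Module.finrank Λ ((eDerivOver F a e).map (evalGen a e)) + r : ℕ) : Cardinal) ≤
      Algebra.trdeg F Λ := by
  classical
  set WΔ := (eDerivOver F a e).map (evalGen a e) with hWΔ
  set m := Module.finrank Λ WΔ with hm
  let bΔ := Module.finBasis Λ WΔ
  have hchoose : ∀ j, ∃ D ∈ eDerivOver F a e, evalGen a e D = (bΔ j : (Fin r → Λ) × (Fin r → Λ)) :=
    fun j => Submodule.mem_map.mp (bΔ j).2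
  choose D hDmem hDev using hchoose
  have hDli : LinearIndependent Λ D := by
    rw [Fintype.linearIndependent_iff]
    intro c hc j₀
    have hb : LinearIndependent Λ (fun j => (bΔ j : (Fin r → Λ) × (Fin r → Λ))) :=
      bΔ.linearIndependent.map' WΔ.subtype (Submodule.ker_subtype _)
    have h0 : ∑ j, c j • (bΔ j : (Fin r → Λ) × (Fin r → Λ)) = 0 := by
      have := congrArg (evalGen a e) hc
      rw [map_sum, map_zero] at this
      simpa only [map_smul, hDev] using this
    exact Fintype.linearIndependent_iff.mp hb c h0 j₀
  have hDexp : ∀ j i, D j (e i) = e i * D j (a i) := fun j i => (hDmem j).2 i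
  -- constants `k₁ ⊇ F`, and the splitting of `ā` modulo `k₁`
  set k₁ : Subring Λ := Transcendental.constantSubring D with hk₁
  have hmemk₁ : ∀ x : Λ, x ∈ k₁ ↔ ∀ j, D j x = 0 := fun x => Iff.rfl
  have hFk₁ : ∀ c : F, algebraMap F Λ c ∈ k₁ := fun c j => (hDmem j).1 c
  set N : Submodule ℚ Λ := ratKer (Set.range D) with hN
  have hmemN : ∀ x : Λ, x ∈ N ↔ ∀ j, D j x = 0 := fun x => mem_ratKer_range_iff
  obtain ⟨r', s, ι, w, hrs, hli_w, hwN, hindep, hgen, -⟩ := exists_split_mod N a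
  -- Ax's theorem for the independent part `a ∘ ι`
  have hind : Transcendental.IsQLinearIndependentMod D (fun i => a (ι i)) := by
    intro q hq
    have hq' : (∑ i, ((q i : ℚ)) • a (ι i)) ∈ N := by
      rw [hmemN]
      intro j
      have := hq j
      rwa [show (∑ i, ((q i : ℚ)) • a (ι i)) = ∑ i, (q i : Λ) * a (ι i) from
        Finset.sum_congr rfl fun i _ => by rw [Rat.smul_def, Rat.cast_intCast]]
    have h := hindep _ hq'
    funext i
    have hi := congr_fun h i
    rw [Pi.zero_apply] at hi ⊢
    exact_mod_cast hi
  have hAx := Ax1971.add_rank_le_trdeg D (fun i => a (ι i)) (fun i => e (ι i)) (fun i => he _)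
    (fun j i => hDexp j _) hind
  rw [rank_eval_eq_of_linearIndependent htop hDmem hDli ι hgen] at hAx
  have h1 : ((r' + m : ℕ) : Cardinal) ≤ Algebra.trdeg k₁ Λ :=
    hAx.trans (trdeg_le_of_injective (Subalgebra.val _) Subtype.val_injective)
  -- the integral relations `b̄ ⊆ k₁`, `ē^w ⊆ k₁`
  set b : Fin s → Λ := fun k => ∑ i, (w k i : Λ) * a i with hb
  set eb : Fin s → Λ := fun k => ∏ i, e i ^ w k i with heb
  have hbN : ∀ k, b k ∈ N := fun k => by
    have h := hwN k
    rwa [show (∑ i, ((w k i : ℚ)) • a i) = b k from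
      Finset.sum_congr rfl fun i _ => by rw [Rat.smul_def, Rat.cast_intCast]] at h
  have hbk₁ : ∀ k, b k ∈ k₁ := fun k => (hmemk₁ _).mpr ((hmemN _).mp (hbN k))
  have hebk₁ : ∀ k, eb k ∈ k₁ := fun k => by
    rw [hmemk₁]
    intro j
    have h := derivation_prod_zpow_of_exp (D j) a e he (hDexp j) (w k)
    have h0 : D j (b k) = 0 := (hmemN _).mp (hbN k) j
    rw [hb] at h0
    rw [heb]
    dsimp only
    rw [h, h0, mul_zero]
  -- strongness, and the tower through `k₁`
  have hstr := hstrong s w hli_w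
  set Nz : IntermediateField F Λ := IntermediateField.adjoin F (Set.range b ∪ Set.range eb) with hNz
  have hNzk₁ : ∀ t : Λ, t ∈ Nz → t ∈ k₁ := by
    let k₁S : Subfield Λ :=
      { k₁ with inv_mem' := fun x hx => Transcendental.inv_mem_constantSubring hx }
    let k₁F : IntermediateField F Λ := k₁S.toIntermediateField hFk₁
    have hle : Nz ≤ k₁F := by
      rw [hNz, IntermediateField.adjoin_le_iff]
      rintro t (⟨k, rfl⟩ | ⟨k, rfl⟩)
      · exact hbk₁ k
      · exact hebk₁ k
    intro t ht
    exact hle ht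
  have htower := trdeg_add_le_subring Nz k₁ hFk₁ hNzk₁
  calc ((m + r : ℕ) : Cardinal) = (s : Cardinal) + ((r' + m : ℕ) : Cardinal) := by
        rw [← hrs]; push_cast; ring
    _ ≤ Algebra.trdeg F Nz + Algebra.trdeg k₁ Λ := add_le_add hstr h1
    _ ≤ Algebra.trdeg F Λ := htower

/-! ### Thm. 6.3 (f.g. case): the defect map is onto, and derivations can be made exponential -/

/-- **Every defect is realised by a derivation over `F`** (Kirby 2010, proof of Thm. 6.3: the
`ω̂ᵢ` are `F₂`-linearly independent in `Ω(F₂/F₁)`, dual form). For strong `(F, ā, ē)` with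
`Λ = F(ā, ē)`, `eᵢ ≠ 0`, and any `y ∈ Λʳ` there is a derivation `v` of `Λ` vanishing on `F` with
`v eᵢ - eᵢ v aᵢ = yᵢ` for all `i`: by `finrank_eDerivOver_add_le_trdeg` and
`trdeg_le_finrank_map_derivOver` the kernel of the defect map on `Der(Λ/F)` has codimension
`≥ r`. [cite: Kirby2010, Thm. 6.3 (proof)] -/
theorem exists_derivOver_defect_eq [CharZero Λ] (a e : Fin r → Λ) (he : ∀ i, e i ≠ 0)
    (htop : IntermediateField.adjoin F (Set.range a ∪ Set.range e) = ⊤)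
    (hstrong : ∀ (s : ℕ) (w : Fin s → Fin r → ℤ),
      LinearIndependent ℚ (fun k i => (w k i : ℚ)) →
        (s : Cardinal) ≤ Algebra.trdeg F (IntermediateField.adjoin F
          (Set.range (fun k => ∑ i, (w k i : Λ) * a i) ∪
            Set.range (fun k => ∏ i, e i ^ w k i))))
    (y : Fin r → Λ) :
    ∃ v ∈ derivOver F Λ, ∀ i, v (e i) - e i * v (a i) = y i := by
  classical
  set W₀ := (derivOver F Λ).map (evalGen a e) with hW₀
  set WΔ := (eDerivOver F a e).map (evalGen a e) with hWΔ
  have hle : WΔ ≤ W₀ := Submodule.map_mono (eDerivOver_le_derivOver a e)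
  set f := (defectVec e).comp W₀.subtype with hf
  -- `ker f ≅ WΔ`
  have hkerW : LinearMap.ker f = WΔ.comap W₀.subtype := by
    ext x
    simp only [hf, LinearMap.mem_ker, LinearMap.coe_comp, Function.comp_apply,
      Submodule.coe_subtype, Submodule.mem_comap]
    obtain ⟨D, hD, hDx⟩ := Submodule.mem_map.mp x.2
    constructor
    · intro h
      refine Submodule.mem_map.mpr ⟨D, ⟨hD, fun i => ?_⟩, hDx⟩
      have := congr_fun h i
      rw [← hDx, defectVec_evalGen, Pi.zero_apply] at this
      exact sub_eq_zero.mp this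
    · intro h
      obtain ⟨D', hD', hD'x⟩ := Submodule.mem_map.mp h
      funext i
      rw [← hD'x, defectVec_evalGen, hD'.2 i, sub_self, Pi.zero_apply]
  have hker : Module.finrank Λ (LinearMap.ker f) = Module.finrank Λ WΔ := by
    rw [hkerW]
    exact (Submodule.comapSubtypeEquivOfLe hle).finrank_eq
  -- the count
  have hcount : Module.finrank Λ WΔ + r ≤ Module.finrank Λ W₀ := by
    have h := (finrank_eDerivOver_add_le_trdeg a e he htop hstrong).trans
      (trdeg_le_finrank_map_derivOver a e htop)
    exact_mod_cast h
  have hrn := LinearMap.finrank_range_add_finrank_ker f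
  have hrange : LinearMap.range f = ⊤ := by
    apply Submodule.eq_top_of_finrank_eq
    apply le_antisymm (Submodule.finrank_le _)
    rw [Module.finrank_fin_fun]
    omega
  have hy : y ∈ LinearMap.range f := hrange ▸ Submodule.mem_top
  obtain ⟨x, hx⟩ := LinearMap.mem_range.mp hy
  obtain ⟨v, hv, hvx⟩ := Submodule.mem_map.mp x.2
  refine ⟨v, hv, fun i => ?_⟩
  have := congr_fun hx i
  rw [hf, LinearMap.coe_comp, Function.comp_apply, Submodule.coe_subtype, ← hvx,
    defectVec_evalGen] at this
  exact this

/-- **Kirby 2010, Thm. 6.3, finitely generated case** (extension of derivations to exponential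
pairs along a strong extension). Let `Λ = F(ā, ē)` with `eᵢ ≠ 0` and `(F, ā, ē)` strong. Then
every derivation `δ'` of `Λ` agrees on `F` with a derivation `δ` of `Λ` which is exponential on the
pairs: `δ eᵢ = eᵢ δ aᵢ` for all `i` (correct `δ'` by a derivation over `F` with the same defect,
`exists_derivOver_defect_eq`). In Kirby's words: "there is `η ∈ EDer(F₂/∂) ∖ EDer(F₂/F₁)` …
then `η'` extends `∂` to `F₂`". [cite: Kirby2010, Thm. 6.3] -/
theorem exists_derivation_extend_exp [CharZero Λ] (a e : Fin r → Λ) (he : ∀ i, e i ≠ 0)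
    (htop : IntermediateField.adjoin F (Set.range a ∪ Set.range e) = ⊤)
    (hstrong : ∀ (s : ℕ) (w : Fin s → Fin r → ℤ),
      LinearIndependent ℚ (fun k i => (w k i : ℚ)) →
        (s : Cardinal) ≤ Algebra.trdeg F (IntermediateField.adjoin F
          (Set.range (fun k => ∑ i, (w k i : Λ) * a i) ∪
            Set.range (fun k => ∏ i, e i ^ w k i))))
    (δ' : Derivation ℤ Λ Λ) :
    ∃ δ : Derivation ℤ Λ Λ, (∀ c : F, δ (algebraMap F Λ c) = δ' (algebraMap F Λ c)) ∧
      ∀ i, δ (e i) = e i * δ (a i) := by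
  obtain ⟨v, hv, hveq⟩ := exists_derivOver_defect_eq a e he htop hstrong
    (fun i => δ' (e i) - e i * δ' (a i))
  refine ⟨δ' - v, fun c => by rw [Derivation.sub_apply, hv c, sub_zero], fun i => ?_⟩
  have h := hveq i
  rw [Derivation.sub_apply, Derivation.sub_apply, mul_sub]
  linear_combination -h

end Ext

end Literature.NumberTheory.Transcendental
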